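import Literature.Computability.QuantumComplexity.CountingSimulation
import Literature.Computability.Complexity.CountingGapPProofs
import Literature.Computability.Complexity.CountingHierarchy
import Literature.Computability.Complexity.OracleProofs
import Literature.Computability.Cryptography.ClassBQPProofs
import HarnessLib

/-!
# `AWPP ⊆ PP` (Fenner–Fortnow–Kurtz–Li) — proof

Sibling proof file of `CountingSimulation.lean` (D-0014: the named fact `AWPP_subset_PP` stays a
`def`; this file discharges it as `AWPP_subset_PP_holds`). The proof needs the `#P`/`GapP` toolkit
of `Literature/Computability/Complexity/CountingGapPProofs.lean` (the sum relation
`PPGapP.exists_sumRel`, padded witness relations `exists_padRel`, and the proved `GapP`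
characterisation of `PP`, `PPGapP.mem_PP_of_gapP` = Fenner–Fortnow–Kurtz 1994, Prop. 4.2(1)),
which `CountingSimulation.lean` does not import — hence a separate file.

Printed background. Fenner–Fortnow–Kurtz–Li define `PP` by "`x ∈ L ⟺ f(x) > 0` for some
`f ∈ GapP`" (Def. 2.3) and `AWPP` by `GapP` functions `g` with `g(x)/2^{q(n)} ∈ [1 - 2^{-r(n)}, 1]`
on members and `∈ [0, 2^{-r(n)}]` on non-members (Def. 6.1 of the expanded version = §6.1; the
tree's `AWPP` is Fenner's equivalent constant-error form, error `1/3`, recorded at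
`Literature.Computability.QuantumComplexity.AWPP`), and remark that `AWPP` is even *low* for `PP`
(Li 1993; Fenner 2003), in particular `AWPP ⊆ PP`. The inclusion itself is the one-line threshold
argument written in the docstring of `AWPP_subset_PP`: if `g ∈ GapP` and `p` witness `L ∈ AWPP`,
then `x ∈ L ↔ 0 < 2·g(x) - 2^{p(|x|)}`, and `2g - 2^{p}` is again in `GapP` by the closure
properties of `GapP` (Fenner–Fortnow–Kurtz 1994, §3: `GapP` is closed under subtraction, sums and
contains `FP`-computable exponentials), so `L ∈ PP` by the `GapP` form of `PP`.

Rendering in the tree's conventions (`GapP := #P - #P`, `#P` = exact-length witness counts of a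
`P` relation, `PP = pMajority P`):

* `AWPPPP.two_mul_mem_SharpP` — `f ∈ #P ⇒ 2f ∈ #P`: one extra witness bit, both branches running
  the same relation (`PPGapP.exists_sumRel R R`);
* `AWPPPP.two_pow_mem_SharpP` — `x ↦ 2^{p(|x|)}` is in `#P` (every witness of the full relation
  `⊤ ∈ P` counts);
* `AWPPPP.add_mem_SharpP` — `f, h ∈ #P ⇒ f + h ∈ #P`: pad both relations to the common witness
  length `(q₁ + q₂)(|x|)` (`exists_padRel`, `countWitnesses_of_padSpec`) and branch on one extra
  bit (`PPGapP.exists_sumRel`) — the machine "branch once, then simulate one of two machines" of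
  Fenner–Fortnow–Kurtz 1994, proof of Prop. 3.5;
* `AWPPPP.gapP_two_mul_sub_two_pow` — hence `g ∈ GapP ⇒ 2g - 2^{p(|·|)} ∈ GapP`
  (`2(f₁ - f₂) - 2^p = 2f₁ - (2f₂ + 2^p)`);
* `AWPPPP.mem_iff_threshold` — the arithmetic of the thresholds `2/3`, `1/3` versus `1/2`;
* `AWPP_subset_PP_holds` — the discharge, via `PPGapP.mem_PP_of_gapP`.

No definitions are introduced.

## References

* S. Fenner, L. Fortnow, S. Kurtz, L. Li, *An oracle builder's toolkit*, Inform. and Comput. 182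
  (2003) 95–136 (expanded version of Structures 1993), Def. 2.3 (`PP` via `GapP`), §6.1,
  Def. 6.1 (`AWPP`) and the remarks following it (`AWPP` is low for `PP`: Li 1993, Fenner 2003).
* S. Fenner, L. Fortnow, S. Kurtz, *Gap-definable counting classes*, J. Comput. System Sci. 48
  (1994) 116–148, §3 (closure properties of `GapP`, Prop. 3.5), Prop. 4.2(1) (`PP` via `GapP`).
* S. Fenner, *PP-lowness and a simple definition of AWPP*, Theory Comput. Syst. 36 (2003)
  199–212 (constant-error form of `AWPP`; `AWPP ⊆ APP ⊆ PP`).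
-/

noncomputable section

open Computability Literature.Computability.Complexity Literature.Computability.Cryptography

namespace Literature.Computability.QuantumComplexity

open Polynomial Literature.Computability.Complexity.TTClosure
  Literature.Computability.Complexity.PPSharpP Literature.Computability.Complexity.PPGapP

namespace AWPPPP

/-! ### Closure properties of `#P` and `GapP` -/

/-- **`#P` is closed under doubling**: `f ∈ #P ⇒ (x ↦ 2·f(x)) ∈ #P` — count witnesses `b·y` of
length `q(|x|) + 1` for the relation that ignores the branch bit `b` and runs `R` on `⟨x, y⟩`
(`PPGapP.exists_sumRel R R`).
[cite: FennerFortnowKurtz1994, §3 (closure properties, proof of Prop. 3.5)] -/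
theorem two_mul_mem_SharpP {f : List Bool → ℕ} (hf : f ∈ SharpP) :
    (fun x => 2 * f x) ∈ SharpP := by
  obtain ⟨R, hR, q, hfq⟩ := hf
  obtain ⟨R', hR', h0, h1⟩ := exists_sumRel hR hR
  refine ⟨R', hR', q + 1, fun x => ?_⟩
  show 2 * f x = countWitnesses R' ((q + 1).eval x.length) x
  rw [eval_add, eval_one, countWitnesses_sumRel h0 h1, ← hfq x, two_mul]

/-- **The exponential `x ↦ 2^{p(|x|)}` is in `#P`**: it counts all witnesses of length `p(|x|)` of
the full relation `⊤ ∈ P`. [cite: FennerFortnowKurtz1994, §3 (closure properties of GapP)] -/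
theorem two_pow_mem_SharpP (p : Polynomial ℕ) :
    (fun x : List Bool => 2 ^ p.eval x.length) ∈ SharpP := by
  have hT : (⊤ : Language Bool) ∈ Classes.P := by
    have h := union_mem_P (HasBit_mem_P true) (compl_mem_P_iff.2 (HasBit_mem_P true))
    rwa [sup_compl_eq_top] at h
  refine ⟨⊤, hT, p, fun x => ?_⟩
  show 2 ^ p.eval x.length = countWitnesses ⊤ (p.eval x.length) x
  rw [countWitnesses_eq_cnt]
  refine (cnt_eq_two_pow_of_forall fun y _ => ?_).symm
  trivial

/-- **`#P` is closed under addition**: `f, h ∈ #P ⇒ f + h ∈ #P` — pad both witness relations to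
the common length `(q₁ + q₂)(|x|)` (`exists_padRel`, which does not change the counts,
`countWitnesses_of_padSpec`) and branch on one extra witness bit (`PPGapP.exists_sumRel`), so
that the number of witnesses of length `(q₁ + q₂)(|x|) + 1` is `f(x) + h(x)`.
[cite: FennerFortnowKurtz1994, §3 (closure properties, proof of Prop. 3.5)] -/
theorem add_mem_SharpP {f h : List Bool → ℕ} (hf : f ∈ SharpP) (hh : h ∈ SharpP) :
    (fun x => f x + h x) ∈ SharpP := by
  obtain ⟨R₁, hR₁, q₁, hf₁⟩ := hf
  obtain ⟨R₂, hR₂, q₂, hf₂⟩ := hh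
  obtain ⟨R₁p, hR₁p, hspec₁⟩ := exists_padRel q₁ hR₁
  obtain ⟨R₂p, hR₂p, hspec₂⟩ := exists_padRel q₂ hR₂
  have hc₁ : ∀ x : List Bool, countWitnesses R₁p ((q₁ + q₂).eval x.length) x = f x := fun x => by
    rw [hf₁ x]
    exact countWitnesses_of_padSpec R₁ R₁p x (q₁.eval x.length) (hspec₁ x) (by simp [eval_add])
  have hc₂ : ∀ x : List Bool, countWitnesses R₂p ((q₁ + q₂).eval x.length) x = h x := fun x => by
    rw [hf₂ x]
    exact countWitnesses_of_padSpec R₂ R₂p x (q₂.eval x.length) (hspec₂ x) (by simp [eval_add])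
  obtain ⟨R, hR, h0, h1⟩ := exists_sumRel hR₁p hR₂p
  refine ⟨R, hR, q₁ + q₂ + 1, fun x => ?_⟩
  show f x + h x = countWitnesses R ((q₁ + q₂ + 1).eval x.length) x
  rw [eval_add, eval_one, countWitnesses_sumRel h0 h1, hc₁, hc₂]

/-- **`GapP` affine closure used for `AWPP ⊆ PP`**: if `g ∈ GapP` and `p` is a polynomial then
`x ↦ 2·g(x) - 2^{p(|x|)}` is in `GapP` — with `g = f₁ - f₂`, `fᵢ ∈ #P`, it is the difference of the
`#P` functions `2f₁` and `2f₂ + 2^{p(|·|)}`.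
[cite: FennerFortnowKurtz1994, §3 (closure properties of GapP)] -/
theorem gapP_two_mul_sub_two_pow {g : List Bool → ℤ} (hg : g ∈ GapP) (p : Polynomial ℕ) :
    (fun x => 2 * g x - (2 : ℤ) ^ p.eval x.length) ∈ GapP := by
  obtain ⟨f₁, hf₁, f₂, hf₂, hgx⟩ := hg
  refine ⟨fun x => 2 * f₁ x, two_mul_mem_SharpP hf₁, fun x => 2 * f₂ x + 2 ^ p.eval x.length,
    add_mem_SharpP (two_mul_mem_SharpP hf₂) (two_pow_mem_SharpP p), fun x => ?_⟩
  show 2 * g x - (2 : ℤ) ^ p.eval x.length =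
    ((2 * f₁ x : ℕ) : ℤ) - ((2 * f₂ x + 2 ^ p.eval x.length : ℕ) : ℤ)
  rw [hgx x]
  push_cast
  ring

/-! ### The threshold -/

/-- **Thresholds.** If `x ∈ L → 2/3 ≤ g(x)/2^m ≤ 1` and `x ∉ L → 0 ≤ g(x)/2^m ≤ 1/3` (written
multiplicatively, `m = p(|x|)`), then `x ∈ L ↔ 0 < 2·g(x) - 2^m`: on members
`3·(2g - 2^m) ≥ 4·2^m - 3·2^m = 2^m > 0`, on non-members `3·(2g - 2^m) ≤ 2·2^m - 3·2^m < 0`.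
[cite: FennerFortnowKurtzLi2003, Def. 2.3 and Def. 6.1] -/
theorem mem_iff_threshold {L : Language Bool} {g : List Bool → ℤ} {m : ℕ} {x : List Bool}
    (hin : x ∈ L → 2 * (2 : ℤ) ^ m ≤ 3 * g x ∧ g x ≤ (2 : ℤ) ^ m)
    (hout : x ∉ L → 0 ≤ g x ∧ 3 * g x ≤ (2 : ℤ) ^ m) :
    x ∈ L ↔ 0 < 2 * g x - (2 : ℤ) ^ m := by
  have hpow : (0 : ℤ) < (2 : ℤ) ^ m := pow_pos two_pos m
  constructor
  · intro hx
    obtain ⟨h₁, -⟩ := hin hx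
    linarith
  · intro hpos
    by_contra hx
    obtain ⟨-, h₂⟩ := hout hx
    linarith

end AWPPPP

open AWPPPP

/-! ### The discharge -/

/-- **`AWPP ⊆ PP`** — discharge of the named fact `AWPP_subset_PP` (`CountingSimulation.lean`).
For `L ∈ AWPP` with witnesses `g ∈ GapP` and `p` (Fenner's constant-error form: `g(x)/2^{p(|x|)}`
in `[2/3, 1]` on members, in `[0, 1/3]` on non-members), `x ∈ L ↔ 0 < 2·g(x) - 2^{p(|x|)}`
(`AWPPPP.mem_iff_threshold`), the function `2g - 2^{p(|·|)}` is in `GapP`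
(`AWPPPP.gapP_two_mul_sub_two_pow`), and a language of the form `{x | 0 < g'(x)}` with `g' ∈ GapP`
is in `PP` (Fenner–Fortnow–Kurtz–Li, Def. 2.3, i.e. Fenner–Fortnow–Kurtz 1994, Prop. 4.2(1), proved
in the tree as `PPGapP.mem_PP_of_gapP`). Fenner–Fortnow–Kurtz–Li record the stronger lowness
`PP^{AWPP} = PP` (Li 1993; Fenner 2003) after Def. 6.1; only the inclusion is formalised here.
[cite: FennerFortnowKurtzLi2003, Def. 2.3 (PP via GapP) and §6.1, Def. 6.1 (AWPP)] -/
theorem AWPP_subset_PP_holds : AWPP_subset_PP := by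
  intro L hL
  obtain ⟨g, hg, p, hp⟩ := hL
  exact mem_PP_of_gapP (gapP_two_mul_sub_two_pow hg p) fun x =>
    mem_iff_threshold (hp x).1 (hp x).2

end Literature.Computability.QuantumComplexity

end

/-!
## `PP^{BQP} = PP` (Fortnow–Rogers 1999, Cor. 3.4): the easy inclusion and the printed assembly

Appended section (provefact unit for the named fact
`Literature.Computability.QuantumComplexity.iUnion_PPRel_BQP_eq_PP`, **quantum-advantage.S17**,
`(⋃ L ∈ BQP, PP^L) = PP`, i.e. `BQP` is low for `PP`).

The printed proof (Fortnow–Rogers, arXiv:cs/9811023 = JCSS 59 (1999), §3, arXiv numbering) is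
the composition of two results:

* **Thm. 3.1** `BQP ⊆ AWPP` (via Lemma 3.2: the acceptance probability of a polynomial-time
  quantum machine with rational amplitudes is `f(x)/5^{2t(|x|)}` for a `GapP` function `f`) — the
  tree's named fact `BQP_subset_AWPP` (`CountingSimulation.lean`, Fenner's dyadic constant-error
  form of `AWPP`);
* **Thm. 3.3** (Li 1993) "`AWPP` is low for `PP`, i.e. `PP^{AWPP} = PP`" (proof sketch ibid.:
  simulate the `PP^A` machine answering each oracle query by the amplified `GapP` function of `A`;
  by Thm. 2.2 — `GapP` is closed under exponential sums and polynomial products, Fenner–Fortnow–Kurtz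
  1994 — the result is a `GapP` function, and the accumulated error over all computation paths does
  not change the sign of the gap), whence **Cor. 3.4** "`BQP` is low for `PP`".

Proved below, with no hypotheses: the inclusion `PP ⊆ PP^{BQP}` (`PP = P·P ⊆ P·P^{L₀} = PP^{L₀}`
for the language `L₀ = ∅ ∈ P ⊆ BQP`, from the tree's `P_subset_PRel_holds` and
`P_subset_BQP_holds`), the reduction of the fact to the lowness of every `BQP` language
(`iUnion_PPRel_BQP_eq_PP_iff_forall_low`), its reading as `PPRelClass BQP = PP` in the vocabulary
of `CountingHierarchy.lean`, and the printed assembly `iUnion_PPRel_BQP_eq_PP_of`: Thm. 3.1 and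
Thm. 3.3 (as hypotheses, the latter spelled `∀ L ∈ AWPP, PP^L ⊆ PP` over the tree's `AWPP`) give
the fact. The discharge `iUnion_PPRel_BQP_eq_PP_holds` awaits these two ingredients, neither of
which is in the tree (Lemma 3.2 rests on the Adleman–DeMarrais–Huang rational-amplitude normal
form, which the tree's Clifford+`T` families do not have: their acceptance probabilities lie in
`ℤ[√2]/2^h`; Thm. 3.3 needs the closure of `GapP` under exponential sums and polynomial products).

References: [FortnowRogers1999JCSS] L. Fortnow, J. Rogers, *Complexity limitations on quantum
computation*, JCSS 59 (1999) 240–252 = arXiv:cs/9811023 (arXiv numbering): Thm. 2.2, Def. 2.5,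
Thm. 3.1, Lemma 3.2, Thm. 3.3 (Li), Cor. 3.4 (p. 5); [FennerFortnowKurtzLi2003IC] Def. 6.1 and
p. 25 (Li's lowness theorem, Fenner's amplification); [BakerGillSolovay1975] §1 (`P ⊆ P^X`).
-/

namespace Literature.Computability.QuantumComplexity

open _root_.Computability Complexity Complexity.Classes Cryptography

/-! ### The easy inclusion `PP ⊆ PP^{BQP}` -/

/-- `PP ⊆ PP^O` for every oracle `O`: `PP = P·P` and `P ⊆ P^O` (`P_subset_PRel_holds`), and the
majority operator is monotone (`pMajority_mono`). [cite: BakerGillSolovay1975, §1] -/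
theorem PP_subset_PPRel (O : Oracle) : PP ⊆ PPRel O :=
  pMajority_mono (P_subset_PRel_holds O)

/-- `BQP` is nonempty: the empty language is in `P ⊆ BQP` (`⊥ = ⊤ᶜ` with `⊤ = A ⊔ Aᶜ` for the `P`
language `A = HasBit 1`). [cite: BernsteinVazirani1997, §8 (P ⊆ BQP)] -/
theorem bot_mem_BQP : (⊥ : Language Bool) ∈ BQP := by
  refine P_subset_BQP_holds ?_
  have hT : (⊤ : Language Bool) ∈ Classes.P := by
    have h := union_mem_P (TTClosure.HasBit_mem_P true)
      (compl_mem_P_iff.2 (TTClosure.HasBit_mem_P true))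
    rwa [sup_compl_eq_top] at h
  have h := compl_mem_P_iff.2 hT
  rwa [compl_top] at h

/-- **`PP ⊆ PP^{BQP}`**, the trivial half of Fortnow–Rogers' Cor. 3.4: `PP ⊆ PP^{L₀}` for the
`BQP` language `L₀ = ∅`. [cite: FortnowRogers1999JCSS, Cor. 3.4 (arXiv numbering)] -/
theorem PP_subset_iUnion_PPRel_BQP : PP ⊆ ⋃ L ∈ BQP, PPRel (Oracle.ofLanguage L) := fun _ hA =>
  Set.mem_iUnion₂.2 ⟨⊥, bot_mem_BQP, PP_subset_PPRel _ hA⟩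

/-! ### Reductions of the fact -/

/-- The fact `iUnion_PPRel_BQP_eq_PP` is literally `PPRelClass BQP = PP` in the vocabulary of
`CountingHierarchy.lean` (`PPRelClass C = ⋃ B ∈ C, PP^B`). [cite: FortnowRogers1999JCSS, Cor. 3.4 (arXiv numbering)] -/
theorem iUnion_PPRel_BQP_eq_PP_iff_PPRelClass : iUnion_PPRel_BQP_eq_PP ↔ PPRelClass BQP = PP :=
  Iff.rfl

/-- **`PP^{BQP} = PP` iff every `BQP` language is low for `PP`**: given the trivial half, the
fact is equivalent to `PP^L ⊆ PP` for every `L ∈ BQP`.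
[cite: FortnowRogers1999JCSS, Cor. 3.4 (arXiv numbering)] -/
theorem iUnion_PPRel_BQP_eq_PP_iff_forall_low :
    iUnion_PPRel_BQP_eq_PP ↔ ∀ L ∈ BQP, PPRel (Oracle.ofLanguage L) ⊆ PP := by
  refine ⟨fun h L hL A hA => ?_, fun h => ?_⟩
  · rw [← show (⋃ L ∈ BQP, PPRel (Oracle.ofLanguage L)) = PP from h]
    exact Set.mem_iUnion₂.2 ⟨L, hL, hA⟩
  · refine Set.Subset.antisymm (fun A hA => ?_) PP_subset_iUnion_PPRel_BQP
    obtain ⟨L, hL, hA⟩ := Set.mem_iUnion₂.1 hA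
    exact h L hL hA

/-! ### The printed assembly -/

/-- **Fortnow–Rogers' proof of `PP^{BQP} = PP`** (Cor. 3.4 from Thm. 3.1 and Thm. 3.3): if
`BQP ⊆ AWPP` (Thm. 3.1, the tree's fact `BQP_subset_AWPP`) and every `AWPP` language is low for
`PP` (Thm. 3.3, Li 1993: `PP^{AWPP} = PP`), then `PP^{BQP} = PP`.
[cite: FortnowRogers1999JCSS, Thm. 3.1, Thm. 3.3 and Cor. 3.4 (arXiv numbering)] -/
theorem iUnion_PPRel_BQP_eq_PP_of (hAWPP : BQP_subset_AWPP)
    (hLi : ∀ L ∈ AWPP, PPRel (Oracle.ofLanguage L) ⊆ PP) : iUnion_PPRel_BQP_eq_PP :=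
  iUnion_PPRel_BQP_eq_PP_iff_forall_low.2 fun L hL => hLi L (hAWPP hL)

end Literature.Computability.QuantumComplexity
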